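import Mathlib.AlgebraicGeometry.ZariskisMainTheorem
import Mathlib.CategoryTheory.Monoidal.Cartesian.Over
import Literature.AlgebraicGeometry.HodgeTheory.GlobalInvariantCycles
import Literature.AlgebraicGeometry.Motives.VarietiesProperProofs
import HarnessLib

/-!
# A proper morphism out of a quasi-projective `k`-scheme is projective in Hartshorne's sense

Topic `Literature/AlgebraicGeometry/HodgeTheory` (family `hodge`; home of `IsQuasiProjectiveOver`,
`GlobalInvariantCycles.lean`). THEOREMS ONLY (no definition, no named fact).

Hartshorne (II §4, p. 103) calls a morphism `f : X → S` PROJECTIVE if it factors as a closed immersion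
`X ↪ ℙᴺ_S = ℙᴺ × S` followed by the projection. Several facts of the tree that are stated for a smooth
projective FAMILY `f : 𝒳 ⟶ S` (`Motives.IsSmoothProjectiveFamily f n`: `f` proper and smooth of relative
dimension `n`, fibres smooth projective) carry this as an EXTRA binder
`∃ (N : ℕ) (ε : 𝒳 ⟶ ℙᴺ ⊗ S), IsClosedImmersion ε.left ∧ ε ≫ snd = f` — Bloch's «`f` smooth and
projective» (`Bloch1972_semiregularSubschemeLifts`, `BlochSemiregularityTheorem.lean`; its consumers
`HeckePrymWeilLine.semiregularSpread_of_blochLifts_of_fulton`,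
`HSemireg.Bloch1972.theorem74_connected_of_blochLifts_of_fulton`, André's deformation inputs) — while
the class-level facts (`BlochSemiregularSpread n p`, the closedness theorem
`charlesSchnell_algebraicityLocus_iUnion_closed`) carry instead «`𝒳` quasi-projective»
(`IsQuasiProjectiveOver 𝒳`). This file proves that the second implies the first for proper `f`:

* `IsQuasiProjectiveOver.exists_isClosedImmersion_projectiveSpace_tensor` — if `X` is quasi-projective
  over the field `k` (an open subscheme `j : X ↪ P` of a projective `P ↪ ℙᴺ_k`) and `f : X ⟶ S` is a
  PROPER `k`-morphism, then `ε = (j ≫ κ, f) : X ⟶ ℙᴺ_k ⊗ S` is a closed immersion over `S`.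

Proof (Hartshorne II Ex. 4.4 / Cor. 4.8 (e); Stacks 01W0 with 04XV): `ε` is a monomorphism because its
first component `X ↪ P ↪ ℙᴺ` is one (open and closed immersions are monomorphisms); `ε` is proper
because `ε ≫ pr₂ = f` is proper and `pr₂ : ℙᴺ ⊗ S ⟶ S` is separated (base change of the proper
`ℙᴺ_k → Spec k`, the tree's `Motives.isProper_projectiveSpace`), Mathlib `IsProper.of_comp`; and a proper
monomorphism of schemes is a closed immersion (Mathlib `IsClosedImmersion.iff_isProper_and_mono`,
Stacks 04XV, via Zariski's Main Theorem). Converse direction (closed in `ℙᴺ ⊗ S` over a quasi-projective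
`S` ⟹ quasi-projective): `IsQuasiProjectiveOver.of_isClosedImmersion_projectiveSpace_tensor`
(`MotivatedClassesDeformationInputs.lean`).

## References

* [Hartshorne1977] R. Hartshorne, *Algebraic Geometry*, GTM 52: II §4, definition of projective and
  quasi-projective morphisms (p. 103), Cor. 4.8 (e) (p. 102), Ex. 4.4.
* [StacksProject] Tags 01W7 (projective morphisms), 04XV (closed immersion = proper monomorphism).
-/

noncomputable section

open CategoryTheory CategoryTheory.Limits AlgebraicGeometry MonoidalCategory

universe u

namespace Literature.AlgebraicGeometry.HodgeTheory

variable {k : Type u} [Field k] {X S : Motives.SchemeOver k}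

/-- **A proper morphism out of a quasi-projective `k`-scheme is projective in Hartshorne's sense.**
If `X` is quasi-projective over the field `k` and `f : X ⟶ S` is a proper morphism of `k`-schemes, then
there are `N` and a CLOSED IMMERSION `ε : X ↪ ℙᴺ_k ⊗ S = ℙᴺ_S` over `S` (`ε ≫ pr₂ = f`): with
`j : X ↪ P` open, `κ : P ↪ ℙᴺ_k` closed, `ε := (j ≫ κ, f)` is a monomorphism (its first component is)
and proper (`f = ε ≫ pr₂` is proper and `pr₂` is separated), and a proper monomorphism is a closed
immersion. This discharges the binder «`f` projective» of `Bloch1972_semiregularSubschemeLifts` and its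
consumers from «`𝒳` quasi-projective, `f` proper».
[cite: Hartshorne1977, II §4 (p. 103, projective morphisms) and Cor. 4.8 (e)]
[cite: StacksProject, Tag 04XV] -/
theorem IsQuasiProjectiveOver.exists_isClosedImmersion_projectiveSpace_tensor
    (f : X ⟶ S) [IsProper f.left] (hX : IsQuasiProjectiveOver X) :
    ∃ (N : ℕ) (ε : X ⟶ Motives.projectiveSpace N k ⊗ S), IsClosedImmersion ε.left ∧
      ε ≫ CartesianMonoidalCategory.snd (Motives.projectiveSpace N k) S = f := by
  obtain ⟨P, j, hP, hj⟩ := hX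
  obtain ⟨N, κ, hκ⟩ := hP
  haveI := hj
  haveI := hκ
  refine ⟨N, CartesianMonoidalCategory.lift (j ≫ κ) f, ?_, CartesianMonoidalCategory.lift_snd _ _⟩
  set ε : X ⟶ Motives.projectiveSpace N k ⊗ S := CartesianMonoidalCategory.lift (j ≫ κ) f with hε
  -- `ε` is a monomorphism: its first component `X ↪ P ↪ ℙᴺ` is one
  have hfst : ε.left ≫ (CartesianMonoidalCategory.fst (Motives.projectiveSpace N k) S).left =
      j.left ≫ κ.left := by
    rw [← Over.comp_left, hε, CartesianMonoidalCategory.lift_fst, Over.comp_left]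
  haveI : Mono (ε.left ≫ (CartesianMonoidalCategory.fst (Motives.projectiveSpace N k) S).left) := by
    rw [hfst]
    exact mono_comp _ _
  haveI : Mono ε.left :=
    mono_of_mono ε.left (CartesianMonoidalCategory.fst (Motives.projectiveSpace N k) S).left
  -- `ε` is proper: `ε ≫ pr₂ = f` is proper and `pr₂` is separated (base change of `ℙᴺ → Spec k`)
  haveI : IsProper (Motives.projectiveSpace N k).hom := Motives.isProper_projectiveSpace N k
  haveI : IsSeparated (CartesianMonoidalCategory.snd (Motives.projectiveSpace N k) S).left := by
    rw [Over.snd_left]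
    exact MorphismProperty.pullback_snd (P := @IsSeparated) _ _ inferInstance
  haveI : IsProper (ε.left ≫ (CartesianMonoidalCategory.snd (Motives.projectiveSpace N k) S).left) := by
    rw [← Over.comp_left, hε, CartesianMonoidalCategory.lift_snd]
    infer_instance
  haveI : IsProper ε.left :=
    IsProper.of_comp ε.left (CartesianMonoidalCategory.snd (Motives.projectiveSpace N k) S).left
  -- a proper monomorphism is a closed immersion
  exact (IsClosedImmersion.iff_isProper_and_mono ε.left).mpr ⟨inferInstance, inferInstance⟩

/-- **Smooth projective families with quasi-projective total space are projective in Hartshorne's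
sense** (the binder shape of `Bloch1972_semiregularSubschemeLifts`): for
`f : 𝒳 ⟶ S` a smooth projective family of relative dimension `n` (in particular proper) with `𝒳`
quasi-projective over `k`, there is a closed `S`-immersion `𝒳 ↪ ℙᴺ ⊗ S`.
[cite: Hartshorne1977, II §4 (p. 103) and Cor. 4.8 (e)] [cite: StacksProject, Tag 04XV] -/
theorem IsQuasiProjectiveOver.exists_isClosedImmersion_projectiveSpace_tensor_of_isSmoothProjectiveFamily
    {n : ℕ} (f : X ⟶ S) (hf : Motives.IsSmoothProjectiveFamily f n) (hX : IsQuasiProjectiveOver X) :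
    ∃ (N : ℕ) (ε : X ⟶ Motives.projectiveSpace N k ⊗ S), IsClosedImmersion ε.left ∧
      ε ≫ CartesianMonoidalCategory.snd (Motives.projectiveSpace N k) S = f :=
  haveI := hf.isProper
  hX.exists_isClosedImmersion_projectiveSpace_tensor f

end Literature.AlgebraicGeometry.HodgeTheory

end
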